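import Literature.NumberTheory.Automorphic.UnboundedDenominatorsFields
import Literature.NumberTheory.Automorphic.UnboundedDenominatorsCommonLevelProofs
import HarnessLib

/-!
# The unbounded denominators theorem (Calegari–Dimitrov–Tang) — §4.2: structure of `M_N ⊆ R_N`

PROOF-ONLY sequel (no definition, no named fact; D-0026) of the definitions instalment
`Literature/NumberTheory/Automorphic/UnboundedDenominatorsFields.lean` (`hol`, `Mer`, the weight-`0`
action, `invariantField`, `modFun m F = F/Δᵐ`, `bddDenGens`/`levelGens`, `bddDenField N = R_N ⊗ ℂ`,
`levelField N = M_N ⊗ ℂ`) and of `UnboundedDenominatorsCommonLevelProofs.lean` (the common level group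
`G_N`). Source: F. Calegari, V. Dimitrov, Y. Tang, *The unbounded denominators conjecture*, J. Amer.
Math. Soc. **38** (2025), 627–702 = arXiv:2109.09040, §4.2 Lemma 4.2.3 (arXiv v1: Lemma 24) and its
proof, and the sentence of §4.3 "because the intersection of `M_{Np}` and `R_N` is `M_N`".

## What is proved

* §1 Invariance as a stabilizer condition (`mem_invariantField_iff_le_stabilizer`,
  `invariantField_sup`), and `E = {±1}` acts trivially on `Mer` (`neg_one_smul_mer`; CDT's groups all
  "contain `E`" for this reason).
* §2 **Lemma 4.2.3, last sentence: "`R_N` is invariant under a normal finite index subgroup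
  `G_N ⊂ ⟨E, Γ(N)⟩` containing `E` with `L(G_N) = N`"** — for the subfield generated by any FINITE set
  of generators of `R_N` (`exists_commonLevel_adjoin_le_invariantField`), and for `R_N` itself as
  soon as it is finitely generated (`exists_commonLevel_bddDenField_le_invariantField`; CDT get finite
  generation from `[R_N : M_2] < ∞`, the holonomy bound — not used here).
* §3 **Wohlfahrt at the level of invariant fields**: an element of `Mer` fixed by a finite-index `G`
  with all conjugates of `Tᴺ` AND by a congruence subgroup is fixed by `Γ(N)`
  (`invariantField_inf_le_invariantField_Gamma`); hence `R_N ∩ M_{N'} ⊆ Mer^{Γ(N)}` for finitely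
  generated `R_N` (`bddDenField_inf_levelField_le_invariantField`) — the function-theoretic heart of
  "the intersection of `M_{Np}` and `R_N` is `M_N`" (the remaining identification
  `M_{N'} ∩ Mer^{Γ(N)} = M_N` is the rationality input of Lemma 4.2.3, not addressed here).
* §4 **Lemma 4.2.3, first sentence: the generators form a monoid** ("the product of any two such
  generators `g` and `h` is also a generator … `gh` is invariant under `G ∩ H` … Lemma 4.1.2"):
  `one_mem_bddDenGens`, `mul_mem_bddDenGens`, `one_mem_levelGens`, `mul_mem_levelGens`; consequently
  `R_N` / `M_N` consist of the quotients of elements of the `ℂ`-SPAN of the generators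
  (`mem_bddDenField_iff`, `mem_levelField_iff`) — the bridge between CDT's spans and our fields.
* §5 A generator of `R_N` fixed by `Γ(N)` is a generator of `M_N` (`mem_levelGens_of_mem_invariantField`:
  bundle the form on `Γ(N)`).

## References

* [CalegariDimitrovTang2025] F. Calegari, V. Dimitrov, Y. Tang, The unbounded denominators
  conjecture, J. Amer. Math. Soc. 38 (2025), no. 3, 627–702; arXiv:2109.09040. §4.2 Lemma 4.2.3 and
  its proof; §4.3 (proof of Theorem 4.3.2).
-/

noncomputable section

namespace Literature.NumberTheory.Automorphic

open scoped MatrixGroups ModularForm Manifold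
open UpperHalfPlane CongruenceSubgroup Matrix.SpecialLinearGroup ModularGroup

namespace UnboundedDenominators

/-! ### §1. Invariance as a stabilizer condition; `E = {±1}` acts trivially -/

/-- `x ∈ Mer^Γ` iff `Γ` is contained in the stabilizer of `x`.
[cite: CalegariDimitrovTang2025, Definition 4.2.1 (setting)] -/
theorem mem_invariantField_iff_le_stabilizer {Γ : Subgroup SL(2, ℤ)} {x : Mer} :
    x ∈ invariantField Γ ↔ Γ ≤ MulAction.stabilizer SL(2, ℤ) x :=
  mem_invariantField_iff.trans
    ⟨fun h _ hγ ↦ MulAction.mem_stabilizer_iff.mpr (h _ hγ),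
      fun h _ hγ ↦ MulAction.mem_stabilizer_iff.mp (h hγ)⟩

/-- `Mer^Γ ∩ Mer^{Γ'} = Mer^{⟨Γ, Γ'⟩}`: an element fixed by two groups is fixed by the group they
generate. [cite: CalegariDimitrovTang2025, proof of Lemma 4.2.3] -/
theorem invariantField_sup (Γ Γ' : Subgroup SL(2, ℤ)) :
    invariantField (Γ ⊔ Γ') = invariantField Γ ⊓ invariantField Γ' := by
  refine le_antisymm (le_inf (invariantField_anti le_sup_left) (invariantField_anti le_sup_right))
    fun x hx ↦ ?_
  obtain ⟨h₁, h₂⟩ := IntermediateField.mem_inf.mp hx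
  rw [mem_invariantField_iff_le_stabilizer] at h₁ h₂ ⊢
  exact sup_le h₁ h₂

/-- The action on `Mer` of a quotient `a/b` of holomorphic functions is computed on `a` and `b`.
[cite: CalegariDimitrovTang2025, Definition 4.2.1 (setting)] -/
theorem smul_algebraMap_div (γ : SL(2, ℤ)) (a b : hol) :
    γ • (algebraMap hol Mer a / algebraMap hol Mer b) =
      algebraMap hol Mer (γ • a) / algebraMap hol Mer (γ • b) := by
  rw [div_eq_mul_inv, smul_mul', smul_inv'', smul_algebraMap, smul_algebraMap, ← div_eq_mul_inv]

/-- `-1 ∈ SL(2, ℤ)` acts trivially on `𝓗` (it acts trivially on `ℍ`). This is why CDT's groups are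
taken to contain `E = {±1}`. [cite: CalegariDimitrovTang2025, §4.1 ("finite index subgroups
containing `E`")] -/
theorem neg_one_smul_hol (f : hol) : (-1 : SL(2, ℤ)) • f = f := by
  ext τ
  rw [smul_hol_apply, show ((-1 : SL(2, ℤ))⁻¹ : SL(2, ℤ)) = -1 by rw [← neg_inv, inv_one],
    SL_neg_smul, one_smul]

/-- `-1 ∈ SL(2, ℤ)` acts trivially on `Mer`. [cite: CalegariDimitrovTang2025, §4.1] -/
theorem neg_one_smul_mer (x : Mer) : (-1 : SL(2, ℤ)) • x = x := by
  obtain ⟨a, b, -, rfl⟩ := IsFractionRing.div_surjective (A := hol) x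
  rw [smul_algebraMap_div, neg_one_smul_hol, neg_one_smul_hol]

/-- `-1` stabilizes every element of `Mer`. [cite: CalegariDimitrovTang2025, §4.1] -/
theorem neg_one_mem_stabilizer (x : Mer) : (-1 : SL(2, ℤ)) ∈ MulAction.stabilizer SL(2, ℤ) x :=
  MulAction.mem_stabilizer_iff.mpr (neg_one_smul_mer x)

/-! ### §2. Lemma 4.2.3: a common level group for finitely many generators of `R_N` -/

/-- **CDT Lemma 4.2.3, last sentence, for finitely many generators** [cite: CalegariDimitrovTang2025,
Lemma 4.2.3 (arXiv v1: Lemma 24)]: for a finite set `s` of generators of `R_N` (`N ≠ 0`) there is a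
normal finite-index `G_N ≤ SL(2, ℤ)` with `-1 ∈ G_N ⊆ ±Γ(N)`, all conjugates of `Tᴺ` in `G_N`,
`L(G_N) = N` — a group of the core case `…iff_core_wohlfahrtLevel` — fixing the field `ℂ(s)`. ("Each
[generator] is invariant under some finite index subgroup `G` containing `E` with `L(G)` dividing
`N`. The intersection of all these groups still has finite index and level `N` … take `G_N` to be
the largest normal subgroup … contained in this intersection.") -/
theorem exists_commonLevel_adjoin_le_invariantField {N : ℕ} (hN : N ≠ 0) {s : Set Mer}
    (hs : s.Finite) (hsub : s ⊆ bddDenGens N) :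
    ∃ (GN : Subgroup SL(2, ℤ)) (_ : GN.FiniteIndex), GN.Normal ∧ (-1 : SL(2, ℤ)) ∈ GN ∧
      (∀ γ ∈ GN, γ ∈ Gamma N ∨ -γ ∈ Gamma N) ∧ (∀ g : SL(2, ℤ), g * T ^ N * g⁻¹ ∈ GN) ∧
      wohlfahrtLevel GN = N ∧ IntermediateField.adjoin ℂ s ≤ invariantField GN := by
  have hch : ∀ u : s, ∃ (G : Subgroup SL(2, ℤ)) (_ : G.FiniteIndex),
      (∀ g : SL(2, ℤ), g * T ^ N * g⁻¹ ∈ G) ∧ (u : Mer) ∈ invariantField G := by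
    rintro ⟨u, hu⟩
    obtain ⟨G, hG, m, F, hT, -, rfl⟩ := hsub hu
    exact ⟨G, hG, hT, algebraMap_modFun_mem_invariantField F⟩
  choose G hGfi hGT hGinv using hch
  haveI := hs.to_subtype
  -- the groups `⟨G_u, -1⟩`
  let G' : s → Subgroup SL(2, ℤ) := fun u ↦ G u ⊔ Subgroup.zpowers (-1)
  haveI hG'fi : ∀ u, (G' u).FiniteIndex := fun u ↦ by
    haveI := hGfi u
    exact Subgroup.finiteIndex_of_le (le_sup_left : G u ≤ G' u)
  obtain ⟨GN, hfi, hn, hneg, hle, hpm, hT, hw⟩ :=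
    exists_commonLevelSubgroup_of_forall_conj_T_pow_mem hN G'
      (fun u ↦ (le_sup_right : Subgroup.zpowers (-1) ≤ G' u) (Subgroup.mem_zpowers _))
      (fun u g ↦ (le_sup_left : G u ≤ G' u) (hGT u g))
  refine ⟨GN, hfi, hn, hneg, hpm, hT, hw, IntermediateField.adjoin_le_iff.mpr fun u hu ↦ ?_⟩
  rw [SetLike.mem_coe, mem_invariantField_iff_le_stabilizer]
  refine (hle ⟨u, hu⟩).trans (sup_le ?_ ?_)
  · exact mem_invariantField_iff_le_stabilizer.mp (hGinv ⟨u, hu⟩)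
  · exact Subgroup.zpowers_le.mpr (neg_one_mem_stabilizer u)

/-- **CDT Lemma 4.2.3, last sentence** [cite: CalegariDimitrovTang2025, Lemma 4.2.3 (arXiv v1:
Lemma 24)]: if `R_N` is finitely generated over `ℂ` as a field (CDT: because `[R_N : M_2] < ∞`),
then `R_N` is fixed by a normal finite-index `G_N` with `-1 ∈ G_N ⊆ ±Γ(N)`, all conjugates of `Tᴺ`
in `G_N`, and `L(G_N) = N`. -/
theorem exists_commonLevel_bddDenField_le_invariantField {N : ℕ} (hN : N ≠ 0)
    (hfg : (bddDenField N).FG) :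
    ∃ (GN : Subgroup SL(2, ℤ)) (_ : GN.FiniteIndex), GN.Normal ∧ (-1 : SL(2, ℤ)) ∈ GN ∧
      (∀ γ ∈ GN, γ ∈ Gamma N ∨ -γ ∈ Gamma N) ∧ (∀ g : SL(2, ℤ), g * T ^ N * g⁻¹ ∈ GN) ∧
      wohlfahrtLevel GN = N ∧ bddDenField N ≤ invariantField GN := by
  classical
  obtain ⟨t, ht⟩ := hfg
  -- each of the finitely many field generators lies in the field of finitely many CDT generators
  have hch : ∀ x : (t : Set Mer), ∃ T : Finset Mer, (T : Set Mer) ⊆ bddDenGens N ∧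
      (x : Mer) ∈ IntermediateField.adjoin ℂ (T : Set Mer) := by
    rintro ⟨x, hx⟩
    have hx' : x ∈ bddDenField N := by
      rw [← ht]
      exact IntermediateField.subset_adjoin ℂ _ hx
    exact IntermediateField.exists_finset_of_mem_adjoin hx'
  choose T hTsub hTmem using hch
  let s : Set Mer := ⋃ x : (t : Set Mer), (T x : Set Mer)
  have hs : s.Finite := Set.finite_iUnion fun x ↦ (T x).finite_toSet
  have hsub : s ⊆ bddDenGens N := Set.iUnion_subset fun x ↦ hTsub x
  obtain ⟨GN, hfi, hn, hneg, hpm, hT, hw, hinv⟩ :=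
    exists_commonLevel_adjoin_le_invariantField hN hs hsub
  refine ⟨GN, hfi, hn, hneg, hpm, hT, hw, ?_⟩
  rw [← ht]
  refine IntermediateField.adjoin_le_iff.mpr fun x hx ↦ ?_
  have hle : IntermediateField.adjoin ℂ (T ⟨x, hx⟩ : Set Mer) ≤ IntermediateField.adjoin ℂ s :=
    IntermediateField.adjoin.mono ℂ _ _ (Set.subset_iUnion (fun y : (t : Set Mer) ↦ (T y : Set Mer))
      ⟨x, hx⟩)
  exact hinv (hle (hTmem ⟨x, hx⟩))

/-! ### §3. Wohlfahrt's theorem at the level of invariant fields -/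

/-- A subgroup containing a congruence subgroup is a congruence subgroup. [folklore] -/
private theorem isCongruenceSubgroup_of_le {Γ Γ' : Subgroup SL(2, ℤ)} (h : Γ ≤ Γ')
    (hΓ : IsCongruenceSubgroup Γ) : IsCongruenceSubgroup Γ' := by
  obtain ⟨M, hM, hle⟩ := hΓ
  exact ⟨M, hM, hle.trans h⟩

/-- **Wohlfahrt, invariant-field form**: an element of `Mer` fixed by a finite-index `G` containing
every conjugate of `Tᴺ` and by a congruence subgroup `Γc` is fixed by `Γ(N)` — its stabilizer
contains `⟨G, Γc⟩`, a congruence subgroup of Wohlfahrt level dividing `N`, hence `⊇ Γ(N)` by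
Wohlfahrt's theorem (`Gamma_le_of_isCongruenceSubgroup_of_forall_conj_T_pow_mem`). This is the group
theory behind "the intersection of `M_{Np}` and `R_N` is `M_N`". [cite: CalegariDimitrovTang2025,
§4.3 (proof of Theorem 4.3.2)] -/
theorem invariantField_inf_le_invariantField_Gamma {G Γc : Subgroup SL(2, ℤ)} {N : ℕ}
    (hT : ∀ g : SL(2, ℤ), g * T ^ N * g⁻¹ ∈ G) (hc : IsCongruenceSubgroup Γc) :
    invariantField G ⊓ invariantField Γc ≤ invariantField (Gamma N) := by
  intro x hx
  obtain ⟨hxG, hxc⟩ := IntermediateField.mem_inf.mp hx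
  rw [mem_invariantField_iff_le_stabilizer] at hxG hxc ⊢
  have hcong : IsCongruenceSubgroup (G ⊔ Γc) := isCongruenceSubgroup_of_le le_sup_right hc
  exact (Gamma_le_of_isCongruenceSubgroup_of_forall_conj_T_pow_mem hcong
    (fun g ↦ (le_sup_left : G ≤ G ⊔ Γc) (hT g))).trans (sup_le hxG hxc)

/-- `M_{N'} ∩ Mer^G ⊆ Mer^{Γ(N)}` for `G` with all conjugates of `Tᴺ` and any `N' ≠ 0`
(`M_{N'} ⊆ Mer^{Γ(N')}`, a congruence subgroup). [cite: CalegariDimitrovTang2025, §4.3 (proof of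
Theorem 4.3.2)] -/
theorem levelField_inf_invariantField_le {G : Subgroup SL(2, ℤ)} {N N' : ℕ}
    (hT : ∀ g : SL(2, ℤ), g * T ^ N * g⁻¹ ∈ G) (hN' : N' ≠ 0) :
    levelField N' ⊓ invariantField G ≤ invariantField (Gamma N) := by
  haveI : NeZero N' := ⟨hN'⟩
  calc levelField N' ⊓ invariantField G ≤ invariantField G ⊓ invariantField (Gamma N') :=
        le_inf inf_le_right (inf_le_left.trans (levelField_le_invariantField N'))
    _ ≤ invariantField (Gamma N) :=
        invariantField_inf_le_invariantField_Gamma hT (Gamma_is_cong_sub N')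

/-- **"The intersection of `M_{Np}` and `R_N` is `M_N`", invariant-field form**
[cite: CalegariDimitrovTang2025, §4.3 (proof of Theorem 4.3.2)]: if `R_N` is finitely generated
(`N ≠ 0`) then `R_N ∩ M_{N'} ⊆ Mer^{Γ(N)}` for every `N' ≠ 0`. (What remains for the printed
equality is the identification of the `Γ(N)`-invariant part of `M_{N'}` with `M_N`, the rationality
statement of Lemma 4.2.3.) -/
theorem bddDenField_inf_levelField_le_invariantField {N N' : ℕ} (hN : N ≠ 0) (hN' : N' ≠ 0)
    (hfg : (bddDenField N).FG) :
    bddDenField N ⊓ levelField N' ≤ invariantField (Gamma N) := by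
  obtain ⟨GN, _, -, -, -, hT, -, hle⟩ := exists_commonLevel_bddDenField_le_invariantField hN hfg
  calc bddDenField N ⊓ levelField N' ≤ levelField N' ⊓ invariantField GN :=
        le_inf inf_le_right (inf_le_left.trans hle)
    _ ≤ invariantField (Gamma N) := levelField_inf_invariantField_le hT hN'

/-! ### §4. Lemma 4.2.3, first sentence: the generators form a monoid -/

/-- Products of power series with integer coefficients have integer coefficients. [folklore] -/
private theorem forall_coeff_int_mul {φ ψ : PowerSeries ℂ}
    (hφ : ∀ n : ℕ, ∃ z : ℤ, PowerSeries.coeff n φ = (z : ℂ))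
    (hψ : ∀ n : ℕ, ∃ z : ℤ, PowerSeries.coeff n ψ = (z : ℂ)) :
    ∀ n : ℕ, ∃ z : ℤ, PowerSeries.coeff n (φ * ψ) = (z : ℂ) := by
  choose a ha using hφ
  choose b hb using hψ
  have hΦ : φ = (PowerSeries.mk a).map (Int.castRingHom ℂ) := by
    ext n
    rw [PowerSeries.coeff_map, PowerSeries.coeff_mk, ha, eq_intCast]
  have hΨ : ψ = (PowerSeries.mk b).map (Int.castRingHom ℂ) := by
    ext n
    rw [PowerSeries.coeff_map, PowerSeries.coeff_mk, hb, eq_intCast]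
  intro n
  refine ⟨PowerSeries.coeff n (PowerSeries.mk a * PowerSeries.mk b), ?_⟩
  rw [hΦ, hΨ, ← map_mul, PowerSeries.coeff_map, eq_intCast]

/-- `1 ∈` the generators of `R_N` (the constant form `1` of weight `0` on `SL(2, ℤ)`).
[cite: CalegariDimitrovTang2025, proof of Lemma 4.2.3] -/
theorem one_mem_levelGens (N : ℕ) : (1 : Mer) ∈ levelGens N := by
  refine ⟨⊤, inferInstance, 0, (1 : ModularForm _ 0).mcast (by simp), le_top, fun n ↦ ?_, ?_⟩
  · rw [ModularForm.qExpansion_mcast, ModularForm.qExpansion_one, PowerSeries.coeff_one]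
    split_ifs
    · exact ⟨1, by simp⟩
    · exact ⟨0, by simp⟩
  · rw [eq_comm, map_eq_one_iff _ algebraMap_hol_injective]
    ext τ
    simp [modFun_apply]

/-- `1 ∈` the generators of `R_N`. [cite: CalegariDimitrovTang2025, proof of Lemma 4.2.3] -/
theorem one_mem_bddDenGens (N : ℕ) : (1 : Mer) ∈ bddDenGens N :=
  levelGens_subset_bddDenGens N (one_mem_levelGens N)

/-- The product of two generators `F/Δᵐ` (on `G`) and `F'/Δ^{m'}` (on `G'`) is the generator
`F F'/Δ^{m+m'}` on `G ∩ G'`. [cite: CalegariDimitrovTang2025, proof of Lemma 4.2.3] -/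
private theorem exists_mul_eq {G G' : Subgroup SL(2, ℤ)} {m m' : ℕ}
    (F : ModularForm (G : Subgroup (GL (Fin 2) ℝ)) (12 * (m : ℤ)))
    (F' : ModularForm (G' : Subgroup (GL (Fin 2) ℝ)) (12 * (m' : ℤ))) :
    ∃ P : ModularForm ((G ⊓ G' : Subgroup SL(2, ℤ)) : Subgroup (GL (Fin 2) ℝ))
      (12 * ((m + m' : ℕ) : ℤ)), (P : ℍ → ℂ) = ⇑F * ⇑F' ∧
      algebraMap hol Mer (modFun m F) * algebraMap hol Mer (modFun m' F') =
        algebraMap hol Mer (modFun (m + m') P) := by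
  have hle : ((G ⊓ G' : Subgroup SL(2, ℤ)) : Subgroup (GL (Fin 2) ℝ)) ≤
      (G : Subgroup (GL (Fin 2) ℝ)) := Subgroup.map_mono inf_le_left
  have hle' : ((G ⊓ G' : Subgroup SL(2, ℤ)) : Subgroup (GL (Fin 2) ℝ)) ≤
      (G' : Subgroup (GL (Fin 2) ℝ)) := Subgroup.map_mono inf_le_right
  obtain ⟨g, hg⟩ := exists_modularForm_restrict hle _ F
  obtain ⟨g', hg'⟩ := exists_modularForm_restrict hle' _ F'
  have e : 12 * (m : ℤ) + 12 * (m' : ℤ) = 12 * ((m + m' : ℕ) : ℤ) := by push_cast; ring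
  refine ⟨(g.mul g').mcast e, by rw [ModularForm.coe_mcast, ModularForm.coe_mul, hg, hg'], ?_⟩
  rw [← map_mul]
  congr 1
  ext τ
  simp only [Subalgebra.coe_mul, Pi.mul_apply, modFun_apply, ModularForm.coe_mcast,
    ModularForm.coe_mul, hg, hg', pow_add, div_mul_div_comm]

/-- **The generators of `R_N` are closed under multiplication** ("`gh` is a holomorphic modular form
with rational coefficients and bounded denominators … invariant under `G ∩ H` … `L(G ∩ H)` also
has Wohlfahrt level dividing `N`"). [cite: CalegariDimitrovTang2025, proof of Lemma 4.2.3] -/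
theorem mul_mem_bddDenGens {N : ℕ} (hN : N ≠ 0) {u v : Mer} (hu : u ∈ bddDenGens N)
    (hv : v ∈ bddDenGens N) : u * v ∈ bddDenGens N := by
  obtain ⟨G, hG, m, F, hT, hint, rfl⟩ := hu
  obtain ⟨G', hG', m', F', hT', hint', rfl⟩ := hv
  obtain ⟨P, hP, hprod⟩ := exists_mul_eq F F'
  have hTT : ∀ x : SL(2, ℤ), x * T ^ N * x⁻¹ ∈ G ⊓ G' := fun x ↦ ⟨hT x, hT' x⟩
  refine ⟨G ⊓ G', inferInstance, m + m', P, hTT, ?_, hprod⟩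
  have hper : ((N : ℕ) : ℝ) ∈
      (((G ⊓ G' : Subgroup SL(2, ℤ))) : Subgroup (GL (Fin 2) ℝ)).strictPeriods :=
    mem_strictPeriods_of_T_pow_mem (by simpa using hTT 1)
  have hq : qExpansion (N : ℝ) P = qExpansion (N : ℝ) F * qExpansion (N : ℝ) F' := by
    rw [hP]
    -- `qExpansion` of a product of modular forms on the common level `G ⊓ G'`
    obtain ⟨g, hg⟩ := exists_modularForm_restrict
      (Subgroup.map_mono inf_le_left : ((G ⊓ G' : Subgroup SL(2, ℤ)) : Subgroup (GL (Fin 2) ℝ)) ≤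
        (G : Subgroup (GL (Fin 2) ℝ))) _ F
    obtain ⟨g', hg'⟩ := exists_modularForm_restrict
      (Subgroup.map_mono inf_le_right : ((G ⊓ G' : Subgroup SL(2, ℤ)) : Subgroup (GL (Fin 2) ℝ)) ≤
        (G' : Subgroup (GL (Fin 2) ℝ))) _ F'
    rw [← hg, ← hg']
    exact ModularForm.qExpansion_mul_coe (Nat.cast_pos.mpr (Nat.pos_of_ne_zero hN)) hper g g'
  rw [hq]
  exact forall_coeff_int_mul hint hint'

/-- **The generators of `M_N` are closed under multiplication.**
[cite: CalegariDimitrovTang2025, proof of Lemma 4.2.3] -/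
theorem mul_mem_levelGens {N : ℕ} (hN : N ≠ 0) {u v : Mer} (hu : u ∈ levelGens N)
    (hv : v ∈ levelGens N) : u * v ∈ levelGens N := by
  obtain ⟨G, hG, m, F, hle, hint, rfl⟩ := hu
  obtain ⟨G', hG', m', F', hle', hint', rfl⟩ := hv
  obtain ⟨P, hP, hprod⟩ := exists_mul_eq F F'
  haveI : NeZero N := ⟨hN⟩
  have hTT : ∀ x : SL(2, ℤ), x * T ^ N * x⁻¹ ∈ G ⊓ G' := fun x ↦ by
    have hTN : T ^ N ∈ Gamma N := by
      have h := CongruenceSubgroup.ModularGroup_T_pow_mem_Gamma N N dvd_rfl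
      rwa [Int.natAbs_natCast, zpow_natCast] at h
    exact ⟨hle ((Gamma_normal N).conj_mem _ hTN x), hle' ((Gamma_normal N).conj_mem _ hTN x)⟩
  refine ⟨G ⊓ G', inferInstance, m + m', P, le_inf hle hle', ?_, hprod⟩
  have hper : ((N : ℕ) : ℝ) ∈
      (((G ⊓ G' : Subgroup SL(2, ℤ))) : Subgroup (GL (Fin 2) ℝ)).strictPeriods :=
    mem_strictPeriods_of_T_pow_mem (by simpa using hTT 1)
  have hq : qExpansion (N : ℝ) P = qExpansion (N : ℝ) F * qExpansion (N : ℝ) F' := by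
    rw [hP]
    obtain ⟨g, hg⟩ := exists_modularForm_restrict
      (Subgroup.map_mono inf_le_left : ((G ⊓ G' : Subgroup SL(2, ℤ)) : Subgroup (GL (Fin 2) ℝ)) ≤
        (G : Subgroup (GL (Fin 2) ℝ))) _ F
    obtain ⟨g', hg'⟩ := exists_modularForm_restrict
      (Subgroup.map_mono inf_le_right : ((G ⊓ G' : Subgroup SL(2, ℤ)) : Subgroup (GL (Fin 2) ℝ)) ≤
        (G' : Subgroup (GL (Fin 2) ℝ))) _ F'
    rw [← hg, ← hg']
    exact ModularForm.qExpansion_mul_coe (Nat.cast_pos.mpr (Nat.pos_of_ne_zero hN)) hper g g'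
  rw [hq]
  exact forall_coeff_int_mul hint hint'

/-- The generators of `R_N` form a submonoid of `Mer`: their monoid closure is themselves.
[cite: CalegariDimitrovTang2025, proof of Lemma 4.2.3] -/
theorem coe_submonoidClosure_bddDenGens {N : ℕ} (hN : N ≠ 0) :
    (Submonoid.closure (bddDenGens N) : Set Mer) = bddDenGens N := by
  let M : Submonoid Mer :=
    { carrier := bddDenGens N
      mul_mem' := fun ha hb ↦ mul_mem_bddDenGens hN ha hb
      one_mem' := one_mem_bddDenGens N }
  exact congrArg SetLike.coe (Submonoid.closure_eq M)

/-- The generators of `M_N` form a submonoid of `Mer`.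
[cite: CalegariDimitrovTang2025, proof of Lemma 4.2.3] -/
theorem coe_submonoidClosure_levelGens {N : ℕ} (hN : N ≠ 0) :
    (Submonoid.closure (levelGens N) : Set Mer) = levelGens N := by
  let M : Submonoid Mer :=
    { carrier := levelGens N
      mul_mem' := fun ha hb ↦ mul_mem_levelGens hN ha hb
      one_mem' := one_mem_levelGens N }
  exact congrArg SetLike.coe (Submonoid.closure_eq M)

/-- **`R_N` versus CDT's span**: an element of the field `R_N` is a quotient `a/b` of two elements
of the `ℂ`-SPAN of the generators (the `ℂ`-algebra they generate IS their span, the generators being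
a monoid). In particular, once the span is a field (e.g. finite-dimensional over `ℂ(λ)`: "any
integral domain which has finite dimension over a field is itself a field"), it equals `R_N`.
[cite: CalegariDimitrovTang2025, Lemma 4.2.3 and its proof] -/
theorem mem_bddDenField_iff {N : ℕ} (hN : N ≠ 0) {x : Mer} :
    x ∈ bddDenField N ↔ ∃ a ∈ Submodule.span ℂ (bddDenGens N),
      ∃ b ∈ Submodule.span ℂ (bddDenGens N), x = a / b := by
  have key : ∀ y : Mer, y ∈ Algebra.adjoin ℂ (bddDenGens N) ↔
      y ∈ Submodule.span ℂ (bddDenGens N) := fun y ↦ by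
    rw [← Subalgebra.mem_toSubmodule, Algebra.adjoin_eq_span, coe_submonoidClosure_bddDenGens hN]
  rw [bddDenField, IntermediateField.mem_adjoin_iff_div]
  simp only [key]

/-- **`M_N` versus CDT's span**: the same for `M_N`. [cite: CalegariDimitrovTang2025, Lemma 4.2.3
and its proof] -/
theorem mem_levelField_iff {N : ℕ} (hN : N ≠ 0) {x : Mer} :
    x ∈ levelField N ↔ ∃ a ∈ Submodule.span ℂ (levelGens N),
      ∃ b ∈ Submodule.span ℂ (levelGens N), x = a / b := by
  have key : ∀ y : Mer, y ∈ Algebra.adjoin ℂ (levelGens N) ↔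
      y ∈ Submodule.span ℂ (levelGens N) := fun y ↦ by
    rw [← Subalgebra.mem_toSubmodule, Algebra.adjoin_eq_span, coe_submonoidClosure_levelGens hN]
  rw [levelField, IntermediateField.mem_adjoin_iff_div]
  simp only [key]

/-- The `ℂ`-span of the generators of `R_N` is contained in `R_N`, and is a subalgebra.
[cite: CalegariDimitrovTang2025, Lemma 4.2.3] -/
theorem span_bddDenGens_le (N : ℕ) :
    Submodule.span ℂ (bddDenGens N) ≤ (bddDenField N).toSubalgebra.toSubmodule :=
  Submodule.span_le.mpr (IntermediateField.subset_adjoin ℂ _)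

/-! ### §5. `Γ(N)`-invariant generators of `R_N` are generators of `M_N` -/

/-- **A generator `F/Δᵐ` of `R_N` fixed by `Γ(N)` is a generator of `M_N`**: `F` is then
`Γ(N)`-invariant in weight `12m` (`slash_eq_of_forall_smul_modFun_eq`), so it is a modular form on
`Γ(N)` with the same (integral) `q`-expansion. [cite: CalegariDimitrovTang2025, Lemma 4.2.3
("`M_N` may be identified with the field of rational functions on the modular curve `Y(N)`")] -/
theorem mem_levelGens_of_mem_invariantField {N : ℕ} (hN : N ≠ 0) {u : Mer}
    (hu : u ∈ bddDenGens N) (hinv : u ∈ invariantField (Gamma N)) : u ∈ levelGens N := by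
  obtain ⟨G, hG, m, F, -, hint, rfl⟩ := hu
  haveI : NeZero N := ⟨hN⟩
  have hfix : ∀ γ ∈ Gamma N, γ • modFun m F = modFun m F := fun γ hγ ↦
    algebraMap_hol_injective (by
      rw [← smul_algebraMap]
      exact mem_invariantField_iff.mp hinv γ hγ)
  have hslash : ∀ γ ∈ Gamma N, (⇑F : ℍ → ℂ) ∣[12 * (m : ℤ)] γ = ⇑F := fun γ hγ ↦
    slash_eq_of_forall_smul_modFun_eq F hfix hγ
  -- bundle `F` on `Γ(N)`
  let F' : ModularForm ((Gamma N : Subgroup SL(2, ℤ)) : Subgroup (GL (Fin 2) ℝ)) (12 * (m : ℤ)) :=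
    { toFun := F
      slash_action_eq' := by
        rintro _ ⟨γ, hγ, rfl⟩
        exact hslash γ hγ
      holo' := F.holo'
      bdd_at_cusps' := fun hc ↦ F.bdd_at_cusps'
        ((Subgroup.IsArithmetic.isCusp_iff_isCusp_SL2Z _).mpr
          ((Subgroup.IsArithmetic.isCusp_iff_isCusp_SL2Z _).mp hc)) }
  have hcoe : (F' : ℍ → ℂ) = F := rfl
  refine ⟨Gamma N, inferInstance, m, F', le_rfl, ?_, ?_⟩
  · rw [hcoe]
    exact hint
  · rw [modFun_eq_of_coe_eq m hcoe]

/-- Hence a generator of `R_N` fixed by `Γ(N)` lies in `M_N`. [cite: CalegariDimitrovTang2025,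
Lemma 4.2.3] -/
theorem mem_levelField_of_mem_bddDenGens_of_mem_invariantField {N : ℕ} (hN : N ≠ 0) {u : Mer}
    (hu : u ∈ bddDenGens N) (hinv : u ∈ invariantField (Gamma N)) : u ∈ levelField N :=
  IntermediateField.subset_adjoin ℂ _ (mem_levelGens_of_mem_invariantField hN hu hinv)

end UnboundedDenominators

end Literature.NumberTheory.Automorphic

end
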